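import Summits.HubbardSuperconductivity.HubbardSuperconductivity.Theorems.SoloBlindPairCondensate
import Summits.HubbardSuperconductivity.HubbardSuperconductivity.Theorems.SoloBlindDWaveModeCount
import Summits.HubbardSuperconductivity.HubbardSuperconductivity.Theorems.SoloBlindCrutchAxis
import HarnessLib

/-!
# Theorem 22: the kinematic floor `Λ_L ≥ (1-δ) L⁴ / 4096`, and `d`-wave order on the crutch axis

Solo programme `solo-HubbardSuperconductivity-blind`, structural Theorem 22 (assembly of
`SoloBlindPairCondensate` and `SoloBlindDWaveModeCount`) and the headline corollary of Theorem 23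
(`SoloBlindCrutchAxis`).

* `exists_szSector_dWave_order_ge` — **Theorem 22.** For `0 ≤ δ ≤ 1/2` and every side `L ≥ 32` the
  summit's doped sector `K_L = (2⌊(1-δ)L²/2⌋, S^z = 0)` of the fermionic torus contains a nonzero
  vector `φ` with `re ⟨φ, ΔᴴΔ φ⟩ ≥ (1-δ)/4096 · L⁴ · re⟨φ,φ⟩`, `Δ = pairField dWaveFormFactor L
  = √2 Δ_d`: the signed momentum pair condensate over the `≥ ¾L² - 4L` momenta with
  `|w_d(k)| ≥ √2/16`, at pair number `n = ⌊(1-δ)L²/2⌋ ≤ L²/2` (`γ² n (m - n + 1) ≥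
  (1/128)((1-δ)L²/4)(L²/8)`);
* `orderCeiling_ge` — hence the ORDER CEILING `Λ_L = max spec(ΔᴴΔ | K_L) ≥ (1-δ) L⁴/4096`: the
  summit's order functional CAN be of order `L⁴` in its sector, with a `U`-independent constant, so
  the summit (`re ⟨φ, ΔᴴΔ φ⟩ ≥ c L⁴` for the Hubbard ground states) asks them to retain a fixed
  fraction of the kinematic maximum;
* `hubbard_crutch_dWave_hasLongRangeOrder` — **Corollary of Theorems 22–23 (the summit's
  conclusion on the crutch axis).** For `U ≥ 0`, `δ ∈ (0,1/2)` and `g ≥ 16384 (8+U)/(1-δ)`, EVERY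
  family of normalised ground states, in the summit's sectors, of the crutched Hamiltonians
  `hubbardTorus 2 L 1 U - (g/L²) ΔᴴΔ` has `HasLongRangeOrder` of the `d`-wave pair correlations —
  literally the conclusion of `HubbardSuperconductivity` with `H_L(g)` for `H_L(0)`.

The summit is the case `g = 0`; Theorem 24 (`SoloBlindCrutchAxis`) records that the every-ground-
state order is monotone in `g` and that the summit is equivalent to the linear energy depression
`E_L(0) - E_L(g) ≥ c g L²` (`g ≥ 0`) together with attainment of the `g → 0⁺` slope at `g = 0`.
[this work]
-/

noncomputable section

namespace Summit.HubbardSuperconductivity.HubbardSuperconductivity.Theorems.KinematicFloor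

open Matrix Literature.Probability.LatticeModels Literature.MathematicalPhysics.QuantumLattice
  Literature.MathematicalPhysics.QuantumLattice.EigenvalueContinuation
open scoped ComplexOrder

variable {L : ℕ} [NeZero L]

/-- **Theorem 22 (kinematic floor at the summit's filling).** `0 ≤ δ ≤ 1/2`, `L ≥ 32`: the sector
`(2⌊(1-δ)L²/2⌋, S^z = 0)` contains `φ ≠ 0` with `(1-δ)/4096 · L⁴ · re⟨φ,φ⟩ ≤ re ⟨φ, ΔᴴΔ φ⟩`.
[this work] -/
theorem exists_szSector_dWave_order_ge {δ : ℝ} (hδ0 : 0 ≤ δ) (hδ : δ ≤ 1 / 2) (hL : 32 ≤ L) :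
    ∃ φ : Fock (Orb (FermionTorus 2 L)),
      φ ∈ szSector (Λ := FermionTorus 2 L) (2 * ⌊(1 - δ) * (L : ℝ) ^ 2 / 2⌋₊) 0 ∧ φ ≠ 0 ∧
        (1 - δ) / 4096 * (L : ℝ) ^ 4 * (star φ ⬝ᵥ φ).re ≤
          (star φ ⬝ᵥ ((pairField dWaveFormFactor L)ᴴ * pairField dWaveFormFactor L) *ᵥ φ).re := by
  classical
  set A := Finset.univ.filter fun k : TorusSite 2 L =>
    Real.sqrt 2 / 16 ≤ |pairFieldMode dWaveFormFactor L k| with hA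
  set n := ⌊(1 - δ) * (L : ℝ) ^ 2 / 2⌋₊ with hn
  have hL' : (32 : ℝ) ≤ L := by exact_mod_cast hL
  have hcard : 3 / 4 * (L : ℝ) ^ 2 - 4 * L ≤ (A.card : ℝ) := DWaveModeCount.card_good_ge
  have h1δ : 1 / 2 ≤ 1 - δ := by linarith
  have hx0 : 0 ≤ (1 - δ) * (L : ℝ) ^ 2 / 2 := by positivity
  have hnle : (n : ℝ) ≤ (1 - δ) * (L : ℝ) ^ 2 / 2 := Nat.floor_le hx0
  have hnge : (1 - δ) * (L : ℝ) ^ 2 / 2 - 1 ≤ (n : ℝ) := by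
    have := Nat.lt_floor_add_one ((1 - δ) * (L : ℝ) ^ 2 / 2)
    linarith
  have hn1 : 1 ≤ n := by
    rw [hn, Nat.one_le_floor_iff]
    nlinarith
  have hnA : n ≤ A.card := by
    have : (n : ℝ) ≤ A.card := by nlinarith
    exact_mod_cast this
  obtain ⟨φ, hφK, hφ0, hφ⟩ := PairCondensate.exists_szSector_order_ge A (γ := Real.sqrt 2 / 16)
    (by positivity) (fun k hk => (Finset.mem_filter.1 hk).2) hn1 hnA
  refine ⟨φ, hφK, hφ0, le_trans ?_ hφ⟩
  have hpos : 0 ≤ (star φ ⬝ᵥ φ).re := (re_star_dotProduct_self_pos hφ0).le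
  apply mul_le_mul_of_nonneg_right _ hpos
  have hγ : (Real.sqrt 2 / 16) ^ 2 = 1 / 128 := by
    rw [div_pow, Real.sq_sqrt (by norm_num)]; norm_num
  rw [hγ]
  have h1 : (1 - δ) * (L : ℝ) ^ 2 / 4 ≤ n := by nlinarith
  have h2 : (L : ℝ) ^ 2 / 8 ≤ (A.card : ℝ) - n + 1 := by nlinarith
  have h3 : 0 ≤ (1 - δ) * (L : ℝ) ^ 2 / 4 := by positivity
  calc (1 - δ) / 4096 * (L : ℝ) ^ 4 = 1 / 128 * ((1 - δ) * (L : ℝ) ^ 2 / 4) * ((L : ℝ) ^ 2 / 8) := by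
        ring
    _ ≤ 1 / 128 * (n : ℝ) * ((A.card : ℝ) - n + 1) := by gcongr

/-- **The order ceiling is of order `L⁴`**: `Λ_L = -minEnergyOn (-ΔᴴΔ) K_L ≥ (1-δ) L⁴ / 4096` for
`L ≥ 32`, `0 ≤ δ ≤ 1/2`. [this work] -/
theorem orderCeiling_ge {δ : ℝ} (hδ0 : 0 ≤ δ) (hδ : δ ≤ 1 / 2) (hL : 32 ≤ L) :
    (1 - δ) / 4096 * (L : ℝ) ^ 4 ≤
      -((-((pairField dWaveFormFactor L)ᴴ * pairField dWaveFormFactor L)).minEnergyOn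
        (szSector (Λ := FermionTorus 2 L) (2 * ⌊(1 - δ) * (L : ℝ) ^ 2 / 2⌋₊) 0)) := by
  obtain ⟨φ, hφK, hφ0, hφ⟩ := exists_szSector_dWave_order_ge (L := L) hδ0 hδ hL
  have h1 := CrutchAxis.re_rayleigh_le_orderCeiling
    (isHermitian_conjTranspose_mul_self (pairField dWaveFormFactor L))
    (szSector (Λ := FermionTorus 2 L) (2 * ⌊(1 - δ) * (L : ℝ) ^ 2 / 2⌋₊) 0) hφK
  exact le_of_mul_le_mul_right (hφ.trans h1) (re_star_dotProduct_self_pos hφ0)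

/-- **Corollary (Theorems 22 + 23): `d`-wave long-range order in every ground state on the crutch
axis.** `U ≥ 0`, `δ ∈ (0, 1/2)`, `g ≥ 16384 (8+U)/(1-δ)`: every family `ψ` of normalised ground
states of `hubbardTorus 2 L 1 U - (g/L²) ΔᴴΔ` in the sectors `(2⌊(1-δ)L²/2⌋, 0)` (hypotheses at
the even sides `L = n+1`) has `HasLongRangeOrder` of the `d`-wave pair correlations, verbatim as in
`HubbardSuperconductivity`. The summit is the same statement at `g = 0`. [this work] -/
theorem hubbard_crutch_dWave_hasLongRangeOrder {U : ℝ} (hU : 0 ≤ U) {δ : ℝ}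
    (hδ : δ ∈ Set.Ioo (0 : ℝ) (1 / 2)) {g : ℝ} (hg : 16384 * (8 + U) / (1 - δ) ≤ g)
    (ψ : ∀ L, Fock (Orb (FermionTorus 2 L)))
    (hψ : ∀ n : ℕ, Even (n + 1) → star (ψ (n + 1)) ⬝ᵥ ψ (n + 1) = 1 ∧
      IsGroundStateInSector
        (hubbardTorus 2 (n + 1) 1 U + ((-(g / ((n + 1 : ℕ) : ℝ) ^ 2) : ℝ) : ℂ) •
          ((pairField dWaveFormFactor (n + 1))ᴴ * pairField dWaveFormFactor (n + 1)))
        (2 * ⌊(1 - δ) * ((n + 1 : ℕ) : ℝ) ^ 2 / 2⌋₊) 0 (ψ (n + 1))) :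
    HasLongRangeOrder (fun k => halfOpenBox 2 (2 * k))
      (fun k => torusPullback (pairFieldCorr dWaveFormFactor ψ) (2 * k)) := by
  have h1δ : 0 < 1 - δ := by linarith [hδ.2]
  have hc : 0 < (1 - δ) / 4096 := by positivity
  have hg' : 4 * (8 + U) / ((1 - δ) / 4096) ≤ g := by
    have : 4 * (8 + U) / ((1 - δ) / 4096) = 16384 * (8 + U) / (1 - δ) := by
      field_simp
      ring
    rwa [this]
  exact CrutchAxis.hubbard_crutch_hasLongRangeOrder hU hδ hc (L₁ := 32)
    (fun n hn => exists_szSector_dWave_order_ge hδ.1.le hδ.2.le hn) hg' ψ hψ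

end Summit.HubbardSuperconductivity.HubbardSuperconductivity.Theorems.KinematicFloor
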